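import Summits.Ventures.HSemireg.Mod4LeadingTermPinsEven

/-!
# Venture HSemireg — MOD-4 line: the `ch(O_Z)`-SHAPE rows for EVEN `n = 2c + 2` at the pin NEXT TO the self-dual one
# (`t = C(n,c)² q_n²`): `dim ker(M_f(q) − t) = 2` iff `C(n+1,c+1)·q_n·q_{n+2} = C(n,c+1)·q_{n+1}²`, else `1` — EVERY even `n`

HONEST FRAMING. Part of the Lean index of the computation cell `pub-hsemireg` (seat w3-mod4-1 gen 14, W3 SPECIAL FIBRES; file of
record `HOME/widen/W3/MOD4-OFFSPLIT-w3mod4.md` §13.26 (c): by pencil, for every even `n`, at the near-self-dual pin the drop is `2`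
iff `C(n+1,n/2)·q_n·q_{n+2} = C(n,n/2)·q_{n+1}²`, else `1` — kernel so far at `n = 2` (FILE 42) and `n = 4` (FILE 43)). THIS FILE
proves BOTH halves for EVERY even `n` (generic «else 1» by injectivity; degenerate «= 2» by rank–nullity on a flag, no solve). ELEMENTARY LINEAR ALGEBRA over a field ONLY: no abelian variety, no sheaf, no Ext group, no
semiregularity map; nothing here says that HC / HC_CM / HC_AV holds; no Literature fact is declared; NO definition is introduced.

SETTING: `n = c + c + 2`, `q_m = 0` for `m < n`, `q_n ≠ 0`, any tail; `μ = (−1)^c C(n,c) q_n`, `t = (−1)ⁿ C(n,c)² q_n²`; by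
`Mod4LeadingTermPinsEven` `dim ker(M_f − t) = dim ker(T_f − μ)`, and `N := T_f − μ` is upper triangular with zero pivots exactly at
`c` and `c + 2`. WHAT IS PROVED:
* **`hankelT_leading_diag_sub_ne_zero`** — the pivot `(−1)^b C(n,b) q_n − (−1)^c C(n,c) q_n` is non-zero for `b ∉ {c, n − c}` (any `n`);
* **`hankelT_apply`** — `(T_f)_{ab} = (−1)^b C(n,b) q_{n−a+b}`; **`hankelT_sub_row_eq`** — a row of `(T_f − μ)v = 0` as a sum;
* **`eq_zero_of_mem_ker_hankelT_nearSelfDual`** — for `v ∈ ker(T_f − μ)` with `v_c = 0`, under the NON-DEGENERACY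
  `C(n+1,c+1) q_n q_{n+2} ≠ C(n,c+1) q_{n+1}²`: `v = 0` (top-down back substitution; at the index `c + 2` the two rows `c`, `c + 1`
  read `x v_{c+1} + y v_{c+2} = 0`, `p v_{c+1} + z v_{c+2} = 0` with `p y − x z = C(n,c+2)·(C(n,c+1) q_{n+1}² − C(n+1,c+1) q_n q_{n+2})`);
* **`finrank_ker_middleM_leading_pin_nearSelfDual_of_ne`** — under the non-degeneracy, `dim ker(M_f − t) = 1` (`≥ 1`:
  `Mod4LeadingTermPins`; `≤ 1`: `v ↦ v_c` is injective on `ker(T_f − μ)`);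
* **`finrank_ker_middleM_leading_pin_nearSelfDual_of_eq`** — in the DEGENERATE case `C(n+1,c+1) q_n q_{n+2} = C(n,c+1) q_{n+1}²`:
  `dim ker(M_f − t) = 2` — WITHOUT a triangular solve: on `U = {v : v_b = 0, b > c+2}` (`dim = c+3`) the `c+1` coordinates
  `(Nv)_{b<c}, (Nv)_{c+1}` have a kernel of dimension `≥ 2` (rank–nullity), which lies in `ker N` since `(Nv)_c ∝ (Nv)_{c+1}` on `U`.
So on the real carrier (FILE 13) the middle entry of a `ch(O_Z)`-shape row on a Weil `(4c+4)`-fold at the pin `C(n,c)²q_n²` is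
`(n+3)C(2n,n) − 2(n+1) − 1` off the hypersurface `C(n+1,c+1)q_nq_{n+2} = C(n,c+1)q_{n+1}²` and `− 2` on it (`n = 2`: `3q₂q₄ = 2q₃²`;
`n = 4`: `5q₄q₆ = 3q₅²`; `n = 6`: `7q₆q₈ = 4q₇²`). Everything PROVED, 0 sorry. Namespace `Summit.Ventures.HSemireg.Mod4`.
References: [BourbakiAlgebre1a3] Ch. III §8; [BuchweitzFlenner2008HH] Prop. 6.4.4 (why these matrices).
-/

namespace Summit.Ventures.HSemireg.Mod4

open Finset Matrix

variable {K : Type*} [Field K]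

/-- **the pivots of `T_f − μ_c` off `{c, n − c}` are non-zero:** `(−1)^b C(n,b) q_n ≠ (−1)^c C(n,c) q_n` for `b, c ≤ n`,
`b ≠ c`, `b + c ≠ n`, `q_n ≠ 0` (`CharZero K`; square both sides and use `choose_eq_choose_iff`). [cite: BourbakiAlgebre1a3, Ch. III §8] -/
theorem hankelT_leading_diag_sub_ne_zero [CharZero K] {n : ℕ} {q : ℕ → K} (hqn : q n ≠ 0) {b c : ℕ} (hb : b ≤ n) (hc : c ≤ n)
    (hbc : ¬(b = c ∨ b + c = n)) :
    (-1 : K) ^ b * (n.choose b : K) * q n - (-1 : K) ^ c * (n.choose c : K) * q n ≠ 0 := by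
  intro h
  have h1 : ((-1 : K) ^ b * (n.choose b : K)) * q n = ((-1 : K) ^ c * (n.choose c : K)) * q n := by linear_combination h
  have h2 : (-1 : K) ^ b * (n.choose b : K) = (-1 : K) ^ c * (n.choose c : K) := mul_right_cancel₀ hqn h1
  have hsb : ((-1 : K) ^ b) ^ 2 = 1 := by rw [← pow_mul, mul_comm, pow_mul, neg_one_sq, one_pow]
  have hsc : ((-1 : K) ^ c) ^ 2 = 1 := by rw [← pow_mul, mul_comm, pow_mul, neg_one_sq, one_pow]
  have h3 : ((n.choose b : K)) ^ 2 = ((n.choose c : K)) ^ 2 := by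
    have := congrArg (fun x => x ^ 2) h2
    simp only [mul_pow, hsb, hsc, one_mul] at this
    exact this
  have h4 : ((n.choose b ^ 2 : ℕ) : K) = ((n.choose c ^ 2 : ℕ) : K) := by push_cast; exact h3
  have h5 : n.choose b = n.choose c := Nat.pow_left_injective two_ne_zero (Nat.cast_injective h4)
  exact hbc ((choose_eq_choose_iff hc hb).mp h5)

/-- the entries of `T_f(q)`: `(T_f)_{ab} = (−1)^b C(n,b) q_{n − a + b}`. -/
theorem hankelT_apply (n : ℕ) (q : ℕ → K) (a b : Fin (n + 1)) :
    hankelT n q a b = (-1 : K) ^ (b : ℕ) * (n.choose (b : ℕ) : K) * q (n - (a : ℕ) + (b : ℕ)) := rfl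

/-- row `a` of `(T_f − μ) v = 0`, written as a sum. -/
theorem hankelT_sub_row_eq {n : ℕ} {q : ℕ → K} {μ : K} {v : Fin (n + 1) → K}
    (hv : v ∈ LinearMap.ker (Matrix.toLin' (hankelT n q) - μ • LinearMap.id)) (a : Fin (n + 1)) :
    ∑ b : Fin (n + 1), (hankelT n q - μ • (1 : Matrix (Fin (n + 1)) (Fin (n + 1)) K)) a b * v b = 0 := by
  rw [toLin'_sub_smul_id, LinearMap.mem_ker, Matrix.toLin'_apply] at hv
  have h := congr_fun hv a
  simp only [Matrix.mulVec, dotProduct, Pi.zero_apply] at h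
  exact h

/-- **back substitution at the near-self-dual pin (even `n = c + c + 2`, `μ = (−1)^c C(n,c) q_n`):** a kernel vector of `T_f − μ`
with `v_c = 0` vanishes, provided `C(n+1,c+1)·q_n·q_{n+2} ≠ C(n,c+1)·q_{n+1}²` (the rows `c`, `c+1` then force `v_{c+2} = v_{c+1} = 0`;
every other pivot is non-zero). [cite: BourbakiAlgebre1a3, Ch. III §8] -/
theorem eq_zero_of_mem_ker_hankelT_nearSelfDual [CharZero K] {n c : ℕ} (hn : n = c + c + 2) {q : ℕ → K}
    (hq0 : ∀ m, m < n → q m = 0) (hqn : q n ≠ 0) {μ : K} (hμ : μ = (-1 : K) ^ c * (n.choose c : K) * q n)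
    (hnd : ((n + 1).choose (c + 1) : K) * q n * q (n + 2) ≠ (n.choose (c + 1) : K) * (q (n + 1) * q (n + 1)))
    {v : Fin (n + 1) → K} (hv : v ∈ LinearMap.ker (Matrix.toLin' (hankelT n q) - μ • LinearMap.id))
    (hvc : v ⟨c, by omega⟩ = 0) : v = 0 := by
  set N := hankelT n q - μ • (1 : Matrix (Fin (n + 1)) (Fin (n + 1)) K) with hN
  have hrow := hankelT_sub_row_eq hv
  rw [← hN] at hrow
  have htri : N.BlockTriangular id := blockTriangular_hankelT_leading_sub hq0 μ
  -- entries of `N`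
  have hNdiag : ∀ b : Fin (n + 1), N b b = (-1 : K) ^ (b : ℕ) * (n.choose (b : ℕ) : K) * q n - μ := by
    intro b
    have hb := b.isLt
    rw [hN, Matrix.sub_apply, Matrix.smul_apply, Matrix.one_apply_eq, smul_eq_mul, mul_one, hankelT_apply,
      show n - (b : ℕ) + (b : ℕ) = n by omega]
  have hNoff : ∀ a b : Fin (n + 1), a ≠ b → N a b = (-1 : K) ^ (b : ℕ) * (n.choose (b : ℕ) : K) * q (n - (a : ℕ) + (b : ℕ)) := by
    intro a b hab
    rw [hN, Matrix.sub_apply, Matrix.smul_apply, Matrix.one_apply_ne hab, smul_zero, sub_zero, hankelT_apply]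
  have hc1 : c + 1 < n + 1 := by omega
  have hc2 : c + 2 < n + 1 := by omega
  -- `v (n - j) = 0` by strong induction on `j`
  have key : ∀ j, j ≤ n → v ⟨n - j, by omega⟩ = 0 := by
    intro j
    refine Nat.strong_induction_on j ?_
    intro j ih hj
    have habove : ∀ b' : Fin (n + 1), n - j < (b' : ℕ) → v b' = 0 := by
      intro b' hb'
      have hb'l := b'.isLt
      have h' := ih (n - (b' : ℕ)) (by omega) (by omega)
      have hfin : (⟨n - (n - (b' : ℕ)), by omega⟩ : Fin (n + 1)) = b' := Fin.ext (by simp only; omega)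
      rwa [hfin] at h'
    by_cases hbc : n - j = c
    · have : (⟨n - j, by omega⟩ : Fin (n + 1)) = ⟨c, by omega⟩ := Fin.ext hbc
      rw [this]; exact hvc
    by_cases hbc2 : n - j = c + 2
    · -- rows `c + 1` and `c`: `p v_{c+1} + z v_{c+2} = 0`, `x v_{c+1} + y v_{c+2} = 0`, and `p y − x z ≠ 0`
      have hb2 : (⟨n - j, by omega⟩ : Fin (n + 1)) = ⟨c + 2, hc2⟩ := Fin.ext hbc2
      set i1 : Fin (n + 1) := ⟨c + 1, hc1⟩ with hi1
      set i2 : Fin (n + 1) := ⟨c + 2, hc2⟩ with hi2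
      have h12 : i1 ≠ i2 := by simp [hi1, hi2, Fin.ext_iff]
      -- two-term extraction from a row
      have two : ∀ a : Fin (n + 1), (∀ x : Fin (n + 1), x ≠ i1 → x ≠ i2 → N a x * v x = 0) →
          N a i1 * v i1 + N a i2 * v i2 = 0 := by
        intro a hzero
        have h := hrow a
        rw [← Finset.add_sum_erase _ _ (Finset.mem_univ i1),
          ← Finset.add_sum_erase _ _ (Finset.mem_erase.mpr ⟨h12.symm, Finset.mem_univ i2⟩)] at h
        have hrest : ∑ x ∈ (Finset.univ.erase i1).erase i2, N a x * v x = 0 := by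
          refine Finset.sum_eq_zero fun x hx => ?_
          simp only [Finset.mem_erase, Finset.mem_univ, and_true] at hx
          exact hzero x hx.2 hx.1
        rw [hrest, add_zero] at h
        linear_combination h
      have hvabove : ∀ x : Fin (n + 1), c + 2 < (x : ℕ) → v x = 0 := fun x hx => habove x (by omega)
      -- row `c + 1`
      have E1 := two i1 (by
        intro x hx1 hx2
        have hxl := x.isLt
        have h1 : (x : ℕ) ≠ c + 1 := fun h => hx1 (Fin.ext h)
        have h2 : (x : ℕ) ≠ c + 2 := fun h => hx2 (Fin.ext h)
        by_cases hlt : (x : ℕ) < c + 1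
        · rw [htri (show (x : ℕ) < ((i1 : Fin (n + 1)) : ℕ) from hlt), zero_mul]
        · rw [hvabove x (by omega), mul_zero])
      -- row `c`
      have E2 := two ⟨c, by omega⟩ (by
        intro x hx1 hx2
        have hxl := x.isLt
        have h1 : (x : ℕ) ≠ c + 1 := fun h => hx1 (Fin.ext h)
        have h2 : (x : ℕ) ≠ c + 2 := fun h => hx2 (Fin.ext h)
        by_cases hlt : (x : ℕ) < c
        · rw [htri (show (x : ℕ) < ((⟨c, by omega⟩ : Fin (n + 1)) : ℕ) from hlt), zero_mul]
        · by_cases hxc : (x : ℕ) = c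
          · have : x = ⟨c, by omega⟩ := Fin.ext hxc
            rw [this, hvc, mul_zero]
          · rw [hvabove x (by omega), mul_zero])
      -- the four entries
      have hp : N i1 i1 = -((-1 : K) ^ c * ((n + 1).choose (c + 1) : K) * q n) := by
        rw [hNdiag, hμ, show ((i1 : Fin (n + 1)) : ℕ) = c + 1 from rfl, Nat.choose_succ_succ' n c, pow_succ]
        push_cast
        ring
      have hz : N i1 i2 = (-1 : K) ^ c * (n.choose (c + 2) : K) * q (n + 1) := by
        rw [hNoff _ _ h12, show ((i2 : Fin (n + 1)) : ℕ) = c + 2 from rfl, show ((i1 : Fin (n + 1)) : ℕ) = c + 1 from rfl,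
          show n - (c + 1) + (c + 2) = n + 1 by omega, pow_add, neg_one_sq, mul_one]
      have hx : N ⟨c, by omega⟩ i1 = -((-1 : K) ^ c * (n.choose (c + 1) : K) * q (n + 1)) := by
        rw [hNoff _ _ (by simp [hi1, Fin.ext_iff]), show ((i1 : Fin (n + 1)) : ℕ) = c + 1 from rfl,
          show ((⟨c, by omega⟩ : Fin (n + 1)) : ℕ) = c from rfl, show n - c + (c + 1) = n + 1 by omega, pow_succ]
        ring
      have hy : N ⟨c, by omega⟩ i2 = (-1 : K) ^ c * (n.choose (c + 2) : K) * q (n + 2) := by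
        rw [hNoff _ _ (by simp [hi2, Fin.ext_iff]), show ((i2 : Fin (n + 1)) : ℕ) = c + 2 from rfl,
          show ((⟨c, by omega⟩ : Fin (n + 1)) : ℕ) = c from rfl, show n - c + (c + 2) = n + 2 by omega, pow_add, neg_one_sq,
          mul_one]
      -- eliminate `v_{c+1}`: `(p y − x z) v_{c+2} = 0`
      have hsq : ((-1 : K) ^ c) * ((-1 : K) ^ c) = 1 := by rw [← pow_add, ← two_mul, pow_mul, neg_one_sq, one_pow]
      have helim : ((n.choose (c + 2) : K) * ((n.choose (c + 1) : K) * (q (n + 1) * q (n + 1)) -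
          ((n + 1).choose (c + 1) : K) * q n * q (n + 2))) * v i2 = 0 := by
        rw [hp, hz] at E1
        rw [hx, hy] at E2
        linear_combination ((-1 : K) ^ c * ((n.choose (c + 1) : K) * q (n + 1))) * E1
          - ((-1 : K) ^ c * (((n + 1).choose (c + 1) : K) * q n)) * E2
          - ((n.choose (c + 2) : K) * ((n.choose (c + 1) : K) * (q (n + 1) * q (n + 1)) -
              ((n + 1).choose (c + 1) : K) * q n * q (n + 2)) * v i2) * hsq
      rcases mul_eq_zero.mp helim with h | h
      · exfalso
        rcases mul_eq_zero.mp h with h' | h'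
        · exact (Nat.cast_ne_zero.mpr (Nat.choose_pos (show c + 2 ≤ n by omega)).ne') h'
        · exact hnd (by linear_combination -h')
      · rw [hb2]; exact h
    · -- an ordinary pivot row
      have h := hrow ⟨n - j, by omega⟩
      rw [Finset.sum_eq_single (⟨n - j, by omega⟩ : Fin (n + 1))] at h
      · have hne : N ⟨n - j, by omega⟩ ⟨n - j, by omega⟩ ≠ 0 := by
          rw [hNdiag, hμ]
          exact hankelT_leading_diag_sub_ne_zero hqn (b := n - j) (by omega) (by omega) (by omega)
        rcases mul_eq_zero.mp h with h1 | h1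
        · exact absurd h1 hne
        · exact h1
      · intro x _ hx
        have hxl := x.isLt
        have hxne : (x : ℕ) ≠ n - j := fun h => hx (Fin.ext h)
        by_cases hlt : n - j < (x : ℕ)
        · rw [habove x hlt, mul_zero]
        · rw [htri (show (x : ℕ) < ((⟨n - j, _⟩ : Fin (n + 1)) : ℕ) by simp only; omega), zero_mul]
      · intro h; exact absurd (Finset.mem_univ _) h
  funext i
  have hi := i.isLt
  have h := key (n - (i : ℕ)) (by omega)
  have hfin : (⟨n - (n - (i : ℕ)), by omega⟩ : Fin (n + 1)) = i := Fin.ext (by simp only; omega)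
  rw [hfin] at h
  rw [h, Pi.zero_apply]

/-- **EVEN `n = 2c + 2`, THE PIN NEXT TO THE SELF-DUAL ONE, GENERIC TAIL ⇒ DROP EXACTLY `1`:** for `q_m = 0` (`m < n`), `q_n ≠ 0`,
`t = (−1)ⁿ C(n,c)² q_n²` and `C(n+1,c+1)·q_n·q_{n+2} ≠ C(n,c+1)·q_{n+1}²`: `dim ker(M_f(q) − t) = 1`.
[cite: BourbakiAlgebre1a3, Ch. III §8] [cite: BuchweitzFlenner2008HH, Prop. 6.4.4] -/
theorem finrank_ker_middleM_leading_pin_nearSelfDual_of_ne [CharZero K] {n c : ℕ} (hn : n = c + c + 2) {q : ℕ → K}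
    (hq0 : ∀ m, m < n → q m = 0) (hqn : q n ≠ 0) {t : K}
    (ht : t = (-1 : K) ^ n * ((n.choose c : K) * (n.choose c : K)) * (q n * q n))
    (hnd : ((n + 1).choose (c + 1) : K) * q n * q (n + 2) ≠ (n.choose (c + 1) : K) * (q (n + 1) * q (n + 1))) :
    Module.finrank K ↥(LinearMap.ker (Matrix.toLin' (middleM n q) - t • LinearMap.id)) = 1 := by
  have heven : Even n := ⟨c + 1, by omega⟩
  have hμ : (-1 : K) ^ c * (n.choose c : K) * q n = (-1 : K) ^ c * (n.choose c : K) * q n := rfl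
  refine le_antisymm ?_ (one_le_finrank_ker_middleM_leading_pin hq0 (by omega) ht)
  rw [finrank_ker_middleM_leading_pin_even heven hq0 hqn (a := c) (by omega) hμ ht]
  set W := LinearMap.ker (Matrix.toLin' (hankelT n q) - ((-1 : K) ^ c * (n.choose c : K) * q n) • LinearMap.id) with hW
  let f : ↥W →ₗ[K] K := (LinearMap.proj (⟨c, by omega⟩ : Fin (n + 1))) ∘ₗ W.subtype
  have hf : Function.Injective f := by
    rw [← LinearMap.ker_eq_bot, LinearMap.ker_eq_bot']
    intro v hv
    have hvc : (v : Fin (n + 1) → K) ⟨c, by omega⟩ = 0 := by simpa [f] using hv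
    exact Subtype.ext (eq_zero_of_mem_ker_hankelT_nearSelfDual hn hq0 hqn rfl hnd v.2 hvc)
  have h := LinearMap.finrank_le_finrank_of_injective hf
  rwa [Module.finrank_self] at h

/-- **EVEN `n = 2c + 2`, THE PIN NEXT TO THE SELF-DUAL ONE, DEGENERATE TAIL ⇒ DROP EXACTLY `2`:** for `q_m = 0` (`m < n`),
`q_n ≠ 0`, `t = (−1)ⁿ C(n,c)² q_n²` and `C(n+1,c+1)·q_n·q_{n+2} = C(n,c+1)·q_{n+1}²`: `dim ker(M_f(q) − t) = 2`. No triangular solve: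
on `U = {v : v_b = 0 for b > c+2}` (dimension `c + 3`) the map `v ↦ ((Nv)_b)_{b < c}, (Nv)_{c+1})` to `K^{c+1}` has kernel of
dimension `≥ 2`, and that kernel lies in `ker N` because `(Nv)_c = (x/p)·(Nv)_{c+1}` on `U` in the degenerate case and `(Nv)_b = 0`
for `b ≥ c + 2` automatically (`N = T_f − μ_c`). [cite: BourbakiAlgebre1a3, Ch. III §8] [cite: BuchweitzFlenner2008HH, Prop. 6.4.4] -/
theorem finrank_ker_middleM_leading_pin_nearSelfDual_of_eq [CharZero K] {n c : ℕ} (hn : n = c + c + 2) {q : ℕ → K}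
    (hq0 : ∀ m, m < n → q m = 0) (hqn : q n ≠ 0) {t : K}
    (ht : t = (-1 : K) ^ n * ((n.choose c : K) * (n.choose c : K)) * (q n * q n))
    (hdeg : ((n + 1).choose (c + 1) : K) * q n * q (n + 2) = (n.choose (c + 1) : K) * (q (n + 1) * q (n + 1))) :
    Module.finrank K ↥(LinearMap.ker (Matrix.toLin' (middleM n q) - t • LinearMap.id)) = 2 := by
  have heven : Even n := ⟨c + 1, by omega⟩
  refine le_antisymm (finrank_ker_middleM_leading_pin_le_two hq0 hqn (by omega) ht) ?_
  rw [finrank_ker_middleM_leading_pin_even heven hq0 hqn (a := c) (by omega) rfl ht]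
  set μ : K := (-1 : K) ^ c * (n.choose c : K) * q n with hμ
  set W := LinearMap.ker (Matrix.toLin' (hankelT n q) - μ • LinearMap.id) with hW
  set N := hankelT n q - μ • (1 : Matrix (Fin (n + 1)) (Fin (n + 1)) K) with hN
  have htri : N.BlockTriangular id := blockTriangular_hankelT_leading_sub hq0 μ
  have hNdiag : ∀ b : Fin (n + 1), N b b = (-1 : K) ^ (b : ℕ) * (n.choose (b : ℕ) : K) * q n - μ := by
    intro b
    have hb := b.isLt
    rw [hN, Matrix.sub_apply, Matrix.smul_apply, Matrix.one_apply_eq, smul_eq_mul, mul_one, hankelT_apply,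
      show n - (b : ℕ) + (b : ℕ) = n by omega]
  have hNoff : ∀ a b : Fin (n + 1), a ≠ b → N a b = (-1 : K) ^ (b : ℕ) * (n.choose (b : ℕ) : K) * q (n - (a : ℕ) + (b : ℕ)) := by
    intro a b hab
    rw [hN, Matrix.sub_apply, Matrix.smul_apply, Matrix.one_apply_ne hab, smul_zero, sub_zero, hankelT_apply]
  have hc1 : c + 1 < n + 1 := by omega
  have hc2 : c + 2 < n + 1 := by omega
  -- the zero pivots at `c` and `c + 2 = n - c`
  have hNcc : N ⟨c, by omega⟩ ⟨c, by omega⟩ = 0 := by rw [hNdiag, hμ]; exact sub_self _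
  have hNc2 : N ⟨c + 2, hc2⟩ ⟨c + 2, hc2⟩ = 0 := by
    rw [hNdiag, hμ, show ((⟨c + 2, hc2⟩ : Fin (n + 1)) : ℕ) = c + 2 from rfl,
      show n.choose (c + 2) = n.choose c from Nat.choose_symm_of_eq_add (by omega), pow_add, neg_one_sq, mul_one, sub_self]
  -- `ι`: extension by zero from the first `c + 3` coordinates; `ψ`: the coordinates `0, …, c-1` and `c+1` of `N (ι w)`
  let ι : (Fin (c + 3) → K) →ₗ[K] (Fin (n + 1) → K) :=
    { toFun := fun w i => if h : (i : ℕ) < c + 3 then w ⟨i, h⟩ else 0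
      map_add' := by intro w w'; funext i; simp only [Pi.add_apply]; split_ifs <;> simp
      map_smul' := by intro r w; funext i; simp only [Pi.smul_apply, smul_eq_mul, RingHom.id_apply]; split_ifs <;> simp }
  have hι_lt : ∀ w (i : Fin (n + 1)) (h : (i : ℕ) < c + 3), ι w i = w ⟨i, h⟩ := by
    intro w i h; show (if h : (i : ℕ) < c + 3 then w ⟨i, h⟩ else 0) = _; rw [dif_pos h]
  have hι_ge : ∀ w (i : Fin (n + 1)), c + 3 ≤ (i : ℕ) → ι w i = 0 := by
    intro w i h; show (if h : (i : ℕ) < c + 3 then w ⟨i, h⟩ else 0) = _; rw [dif_neg (by omega)]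
  let τ : Fin (c + 1) → Fin (n + 1) := fun j => if (j : ℕ) < c then ⟨j, by omega⟩ else ⟨c + 1, hc1⟩
  let ψ : (Fin (c + 3) → K) →ₗ[K] (Fin (c + 1) → K) :=
    (LinearMap.pi fun j : Fin (c + 1) => LinearMap.proj (τ j)) ∘ₗ Matrix.toLin' N ∘ₗ ι
  -- rank–nullity for `ψ`: `dim ker ψ ≥ 2`
  have hkerψ : 2 ≤ Module.finrank K ↥(LinearMap.ker ψ) := by
    have h1 := LinearMap.finrank_range_add_finrank_ker ψ
    have h2 : Module.finrank K ↥(LinearMap.range ψ) ≤ c + 1 := by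
      have := Submodule.finrank_le (LinearMap.range ψ)
      rwa [Module.finrank_fin_fun] at this
    rw [Module.finrank_fin_fun] at h1
    omega
  -- every `w ∈ ker ψ` gives a kernel vector `ι w` of `N`
  have hmem : ∀ w : Fin (c + 3) → K, ψ w = 0 → ι w ∈ W := by
    intro w hw
    have hcoord : ∀ j : Fin (c + 1), (N *ᵥ ι w) (τ j) = 0 := by
      intro j
      have := congr_fun hw j
      simpa [ψ, LinearMap.pi_apply, Matrix.toLin'_apply] using this
    rw [hW, toLin'_sub_smul_id, LinearMap.mem_ker, Matrix.toLin'_apply, ← hN]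
    funext b
    rw [Pi.zero_apply]
    have hbl := b.isLt
    -- rows `b ≥ c + 2`: everything vanishes
    by_cases hbig : c + 2 ≤ (b : ℕ)
    · simp only [Matrix.mulVec, dotProduct]
      refine Finset.sum_eq_zero fun j _ => ?_
      have hjl := j.isLt
      by_cases hjb : (j : ℕ) < (b : ℕ)
      · rw [htri hjb, zero_mul]
      · by_cases hje : j = b
        · rw [hje]
          by_cases hb2 : (b : ℕ) = c + 2
          · have : b = ⟨c + 2, hc2⟩ := Fin.ext hb2
            rw [this, hNc2, zero_mul]
          · rw [hι_ge w b (by omega), mul_zero]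
        · have : (b : ℕ) < (j : ℕ) := by
            have : (j : ℕ) ≠ (b : ℕ) := fun h => hje (Fin.ext h)
            omega
          rw [hι_ge w j (by omega), mul_zero]
    · by_cases hbc : (b : ℕ) = c
      · -- row `c`: `x u + y u' = (x/p)(p u + z u')` in the degenerate case
        -- two-term forms of rows `c` and `c+1`
        have two : ∀ a : Fin (n + 1), c ≤ (a : ℕ) → (a : ℕ) ≤ c + 1 → N a a * ι w a = 0 ∨ a = ⟨c + 1, hc1⟩ →
            (N *ᵥ ι w) a = N a ⟨c + 1, hc1⟩ * ι w ⟨c + 1, hc1⟩ + N a ⟨c + 2, hc2⟩ * ι w ⟨c + 2, hc2⟩ := by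
          intro a hca ha hdiag
          simp only [Matrix.mulVec, dotProduct]
          have h12 : (⟨c + 1, hc1⟩ : Fin (n + 1)) ≠ ⟨c + 2, hc2⟩ := by simp [Fin.ext_iff]
          rw [← Finset.add_sum_erase _ _ (Finset.mem_univ (⟨c + 1, hc1⟩ : Fin (n + 1))),
            ← Finset.add_sum_erase _ _ (Finset.mem_erase.mpr ⟨h12.symm, Finset.mem_univ _⟩)]
          have hrest : ∑ x ∈ (Finset.univ.erase (⟨c + 1, hc1⟩ : Fin (n + 1))).erase ⟨c + 2, hc2⟩, N a x * ι w x = 0 := by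
            refine Finset.sum_eq_zero fun x hx => ?_
            simp only [Finset.mem_erase, Finset.mem_univ, and_true, ne_eq, Fin.ext_iff] at hx
            have hxl := x.isLt
            by_cases hlt : (x : ℕ) < (a : ℕ)
            · rw [htri hlt, zero_mul]
            · by_cases hxa : x = a
              · rw [hxa]
                rcases hdiag with hd | hd
                · exact hd
                · exfalso
                  have : (x : ℕ) = c + 1 := by rw [hxa, hd]
                  exact hx.2 this
              · have : (x : ℕ) ≠ (a : ℕ) := fun h => hxa (Fin.ext h)
                rw [hι_ge w x (by omega), mul_zero]
          rw [hrest, add_zero]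
        have hbfin : b = ⟨c, by omega⟩ := Fin.ext hbc
        have Ec := two ⟨c, by omega⟩ (le_refl _) (by simp only; omega) (Or.inl (by rw [hNcc, zero_mul]))
        have Ec1 := two ⟨c + 1, hc1⟩ (by simp only; omega) (le_refl _) (Or.inr rfl)
        have h0 : (N *ᵥ ι w) ⟨c + 1, hc1⟩ = 0 := by
          have := hcoord ⟨c, by omega⟩
          simpa [τ] using this
        -- entries
        have h12 : (⟨c + 1, hc1⟩ : Fin (n + 1)) ≠ ⟨c + 2, hc2⟩ := by simp [Fin.ext_iff]
        have hp : N ⟨c + 1, hc1⟩ ⟨c + 1, hc1⟩ = -((-1 : K) ^ c * ((n + 1).choose (c + 1) : K) * q n) := by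
          rw [hNdiag, hμ, show ((⟨c + 1, hc1⟩ : Fin (n + 1)) : ℕ) = c + 1 from rfl, Nat.choose_succ_succ' n c, pow_succ]
          push_cast
          ring
        have hz : N ⟨c + 1, hc1⟩ ⟨c + 2, hc2⟩ = (-1 : K) ^ c * (n.choose (c + 2) : K) * q (n + 1) := by
          rw [hNoff _ _ h12, show ((⟨c + 2, hc2⟩ : Fin (n + 1)) : ℕ) = c + 2 from rfl,
            show ((⟨c + 1, hc1⟩ : Fin (n + 1)) : ℕ) = c + 1 from rfl, show n - (c + 1) + (c + 2) = n + 1 by omega, pow_add,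
            neg_one_sq, mul_one]
        have hx : N ⟨c, by omega⟩ ⟨c + 1, hc1⟩ = -((-1 : K) ^ c * (n.choose (c + 1) : K) * q (n + 1)) := by
          rw [hNoff _ _ (by simp [Fin.ext_iff]), show ((⟨c + 1, hc1⟩ : Fin (n + 1)) : ℕ) = c + 1 from rfl,
            show ((⟨c, by omega⟩ : Fin (n + 1)) : ℕ) = c from rfl, show n - c + (c + 1) = n + 1 by omega, pow_succ]
          ring
        have hy : N ⟨c, by omega⟩ ⟨c + 2, hc2⟩ = (-1 : K) ^ c * (n.choose (c + 2) : K) * q (n + 2) := by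
          rw [hNoff _ _ (by simp [Fin.ext_iff]), show ((⟨c + 2, hc2⟩ : Fin (n + 1)) : ℕ) = c + 2 from rfl,
            show ((⟨c, by omega⟩ : Fin (n + 1)) : ℕ) = c from rfl, show n - c + (c + 2) = n + 2 by omega, pow_add, neg_one_sq,
            mul_one]
        rw [hbfin, Ec]
        rw [Ec1, hp, hz] at h0
        rw [hx, hy]
        -- `p (x u + y u') = x (p u + z u')` needs `p y = x z`, i.e. the degeneracy
        have hsq : ((-1 : K) ^ c) * ((-1 : K) ^ c) = 1 := by rw [← pow_add, ← two_mul, pow_mul, neg_one_sq, one_pow]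
        have hp0 : ((-1 : K) ^ c * ((n + 1).choose (c + 1) : K) * q n) ≠ 0 :=
          mul_ne_zero (mul_ne_zero (pow_ne_zero _ (neg_ne_zero.mpr one_ne_zero))
            (Nat.cast_ne_zero.mpr (Nat.choose_pos (by omega)).ne')) hqn
        have key : ((-1 : K) ^ c * ((n + 1).choose (c + 1) : K) * q n) *
            (-((-1 : K) ^ c * (n.choose (c + 1) : K) * q (n + 1)) * ι w ⟨c + 1, hc1⟩ +
              (-1 : K) ^ c * (n.choose (c + 2) : K) * q (n + 2) * ι w ⟨c + 2, hc2⟩) = 0 := by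
          linear_combination ((-1 : K) ^ c * (n.choose (c + 1) : K) * q (n + 1)) * h0 +
            ((-1 : K) ^ c * (-1 : K) ^ c * (n.choose (c + 2) : K) * ι w ⟨c + 2, hc2⟩) * hdeg
        rcases mul_eq_zero.mp key with h | h
        · exact absurd h hp0
        · exact h
      · -- rows `b < c` and `b = c + 1`: coordinates of `ψ`
        have hb' : (b : ℕ) < c ∨ (b : ℕ) = c + 1 := by omega
        rcases hb' with hb' | hb'
        · have := hcoord ⟨b, by omega⟩
          simpa [τ, hb'] using this
        · have := hcoord ⟨c, by omega⟩
          have hbfin : b = ⟨c + 1, hc1⟩ := Fin.ext hb'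
          rw [hbfin]
          simpa [τ] using this
  -- the injective linear map `ker ψ → W`
  let g : ↥(LinearMap.ker ψ) →ₗ[K] ↥W :=
    { toFun := fun w => ⟨ι w.1, hmem w.1 w.2⟩
      map_add' := by intro w w'; apply Subtype.ext; simp
      map_smul' := by intro r w; apply Subtype.ext; simp }
  have hg : Function.Injective g := by
    intro w w' h
    have h' : ι w.1 = ι w'.1 := congrArg Subtype.val h
    apply Subtype.ext
    funext i
    have := congr_fun h' ⟨i, by omega⟩
    rwa [hι_lt w.1 ⟨i, by omega⟩ i.isLt, hι_lt w'.1 ⟨i, by omega⟩ i.isLt] at this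
  exact le_trans hkerψ (LinearMap.finrank_le_finrank_of_injective hg)

end Summit.Ventures.HSemireg.Mod4
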